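import Summits.Ventures.PercRepro.RankLevelSetHallLostTransport

/-!
# PercRepro — THE UNIT TRANSPORT (U_p): LOST-SET UNITS ONTO THE `p`-SETS, BETWEEN THE `p`-SET INJECTION AND THE DEFECT
TRANSPORT (p4, gen 36; C-044, UP form; paper proofs/P4-CELL-THREE.md §14.22 (s) ADDENDUM)

A **unit** is a pair `(Z, S)` — a member `Z` inside a lost set `S`; its weight is `1/C(#S, q)`, the LYM weight the lost set
owes to each of its members, and the units through `Z` sum to its defect `δ(Z)` (`sum_lost_through_eq_lymDefect`).
**(U_p)** `UnitTransport M p q` routes every unit, fractionally, to big `Y`-sets of size exactly `p` containing its lost set,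
loading each `p`-set by at most `1`; **(INJ_p)** `LostInjP M p q` is the `p`-set injection of the lost sets (all the units of
one lost set travel together).  Both are `Prop`s, NOT asserted.  In the kernel: (INJ_p) ⟹ (U_p) ⟹ (TR_p) ⟹ (TR) ⟹ the
UP-Hall form (`unitTransport_of_lostInjP`, `bigTransportP_of_unitTransport`, with `bigTransport_of_bigTransportP` and
`hallUp_of_ncard_eq_of_bigTransport`), and `hallUp_of_ncard_eq_of_unitTransport`.  The two steps down are strict on the
witness `M = B₄ ⊕ B₅ ⊕ U_{1,2}` (§14.22 (r)–(s)): (INJ_p) fails there (31,232 / 31,488) while (U_p) holds with scaling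
factor `≈ 4.95`; (U_p) keeps the lost-set structure — at `k = 2` a lost set has nullity one, its members are `S − x` for `x`
in its circuit, and a `p`-set `Y` of rank `p − 1` carries the units `(Y − y − x, Y − y)`, `y` a coloop of `Y` — which is why
it is the statement to prove.
* `LostInjP`, `UnitTransport`;
* `unitTransport_of_lostInjP` — (INJ_p) ⟹ (U_p); `bigTransportP_of_unitTransport` — (U_p) ⟹ (TR_p);
* **`hallUp_of_ncard_eq_of_unitTransport`** — `#E = p + q`, `q < p`, `UnitTransport M p q` ⇒ `Φ(p,q)·#𝒜 ≤ #upNbhd(𝒜)`.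
Axioms: standard.
-/

namespace PercRepro

open Set Matroid Finset

variable {α : Type} (M : Matroid α) [M.Finite]

/-- **(INJ_p)** — a `Prop`, NOT asserted: an injection of the lost sets into the big `Y`-sets of size `p` with `S ⊆ φ S`. -/
def LostInjP (p q : ℕ) : Prop :=
  ∃ φ : Set α → Set α, (∀ S ∈ lostSets M p q, φ S ∈ bigY M p q ∧ (φ S).ncard = p ∧ S ⊆ φ S) ∧
    Set.InjOn φ (lostSets M p q)

/-- **(U_p)** — a `Prop`, NOT asserted: a fractional routing `f Z S Y` of every unit `(Z, S)` (`Z` a member inside the lost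
set `S`) onto `p`-sets `Y ⊇ S` of `Y`, each unit sent with total weight `≥ 1`, each `p`-set `Y` loaded by
`Σ_{(Z,S)} f Z S Y / C(#S, q) ≤ 1`. -/
def UnitTransport (p q : ℕ) : Prop :=
  ∃ f : Set α → Set α → Set α → ℚ, (∀ Z S Y, 0 ≤ f Z S Y) ∧
    (∀ Z S Y, f Z S Y ≠ 0 → Z ∈ cellMembers M p q ∧ S ∈ lostSets M p q ∧ Z ⊆ S ∧ S ⊆ Y ∧
      Y ∈ bigY M p q ∧ Y.ncard = p) ∧
    (∀ Z ∈ cellMembers M p q, ∀ S ∈ lostSets M p q, Z ⊆ S →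
      1 ≤ ∑ Y ∈ (bigY_finite M p q).toFinset, f Z S Y) ∧
    (∀ Y ∈ bigY M p q, ∑ Z ∈ (cellMembers_finite M p q).toFinset, ∑ S ∈ (lostSets_finite M p q).toFinset,
      f Z S Y / ((S.ncard.choose q : ℕ) : ℚ) ≤ 1)

/-- **(INJ_p) ⟹ (U_p)** (tight layer): route every unit `(Z, S)` to `φ S`; a `p`-set is the image of at most one lost set,
whose `≤ C(#S, q)` members load it by at most `1`. -/
theorem unitTransport_of_lostInjP (p q : ℕ) (hE : M.E.ncard = p + q) (h : LostInjP M p q) :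
    UnitTransport M p q := by
  classical
  obtain ⟨φ, hφ, hinj⟩ := h
  set Lf : Finset (Set α) := (lostSets_finite M p q).toFinset with hLf
  set Mf : Finset (Set α) := (cellMembers_finite M p q).toFinset with hMf
  set Bf : Finset (Set α) := (bigY_finite M p q).toFinset with hBf
  have hmemL : ∀ S, S ∈ Lf ↔ S ∈ lostSets M p q := fun S => by
    rw [hLf, (lostSets_finite M p q).mem_toFinset]
  have hmemM : ∀ Z, Z ∈ Mf ↔ Z ∈ cellMembers M p q := fun Z => by
    rw [hMf, (cellMembers_finite M p q).mem_toFinset]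
  have hmemB : ∀ T, T ∈ Bf ↔ T ∈ bigY M p q := fun T => by
    rw [hBf, (bigY_finite M p q).mem_toFinset]
  refine ⟨fun Z S Y => if Z ∈ cellMembers M p q ∧ S ∈ lostSets M p q ∧ Z ⊆ S ∧ φ S = Y then 1 else 0,
    ?_, ?_, ?_, ?_⟩
  · intro Z S Y
    dsimp only
    split_ifs <;> norm_num
  · intro Z S Y hf
    dsimp only at hf
    split_ifs at hf with hc
    · obtain ⟨hZ, hS, hZS, hY⟩ := hc
      obtain ⟨hφB, hφp, hSφ⟩ := hφ S hS
      exact ⟨hZ, hS, hZS, hY ▸ hSφ, hY ▸ hφB, hY ▸ hφp⟩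
    · exact absurd rfl hf
  · intro Z hZ S hS hZS
    dsimp only
    have hφB : φ S ∈ Bf := (hmemB _).2 (hφ S hS).1
    have hpt : ∀ Y ∈ Bf, (if Z ∈ cellMembers M p q ∧ S ∈ lostSets M p q ∧ Z ⊆ S ∧ φ S = Y then (1 : ℚ) else 0)
        = if φ S = Y then 1 else 0 := by
      intro Y _
      by_cases hY : φ S = Y
      · rw [if_pos ⟨hZ, hS, hZS, hY⟩, if_pos hY]
      · rw [if_neg (fun hc => hY hc.2.2.2), if_neg hY]
    rw [Finset.sum_congr rfl hpt, Finset.sum_ite_eq, if_pos hφB]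
  · intro Y hYB
    dsimp only
    -- the inner sum over `S`: only `S` with `φ S = Y` contribute
    have hS : ∀ Z ∈ Mf, ∑ S ∈ Lf, (if Z ∈ cellMembers M p q ∧ S ∈ lostSets M p q ∧ Z ⊆ S ∧ φ S = Y then (1 : ℚ) else 0)
          / ((S.ncard.choose q : ℕ) : ℚ)
        = ∑ S ∈ Lf, (if Z ⊆ S ∧ φ S = Y then 1 / ((S.ncard.choose q : ℕ) : ℚ) else 0) := by
      intro Z hZM
      rw [hmemM] at hZM
      refine Finset.sum_congr rfl (fun S hSL => ?_)
      rw [hmemL] at hSL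
      by_cases hc : Z ⊆ S ∧ φ S = Y
      · rw [if_pos ⟨hZM, hSL, hc.1, hc.2⟩, if_pos hc, one_div]
      · rw [if_neg (fun hc' => hc ⟨hc'.2.2.1, hc'.2.2.2⟩), if_neg hc, zero_div]
    rw [Finset.sum_congr rfl hS, Finset.sum_comm]
    have hS2 : ∀ S ∈ Lf, (∑ Z ∈ Mf, if Z ⊆ S ∧ φ S = Y then 1 / ((S.ncard.choose q : ℕ) : ℚ) else 0)
        ≤ if φ S = Y then 1 else 0 := by
      intro S hSL
      rw [hmemL] at hSL
      by_cases hφS : φ S = Y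
      · simp only [hφS, and_true, if_true]
        rw [Finset.sum_ite, Finset.sum_const_zero, add_zero, Finset.sum_const, nsmul_eq_mul]
        have hcount : (Mf.filter (fun Z => Z ⊆ S)).card ≤ S.ncard.choose q := by
          have h := ncard_members_subset_le_choose M hE hSL.1
          have heq : {Z : Set α | Z ∈ cellMembers M p q ∧ Z ⊆ S}
              = ((Mf.filter (fun Z => Z ⊆ S) : Finset (Set α)) : Set (Set α)) := by
            ext Z
            rw [Finset.coe_filter, Set.mem_setOf_eq, Set.mem_setOf_eq, hmemM]
          rw [heq, ncard_coe_finset] at h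
          exact h
        have hpos : (0 : ℚ) < ((S.ncard.choose q : ℕ) : ℚ) := by
          exact_mod_cast Nat.choose_pos hSL.2.2.1.le
        rw [mul_one_div, div_le_one hpos]
        exact_mod_cast hcount
      · simp only [hφS, and_false, if_false]
        exact le_of_eq (Finset.sum_const_zero)
    refine (Finset.sum_le_sum hS2).trans ?_
    rw [Finset.sum_boole]
    have hcard : (Lf.filter (fun S => φ S = Y)).card ≤ 1 := by
      rw [Finset.card_le_one]
      intro S₁ hS₁ S₂ hS₂
      rw [Finset.mem_filter, hmemL] at hS₁ hS₂
      exact hinj hS₁.1 hS₂.1 (hS₁.2.trans hS₂.2.symm)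
    exact_mod_cast hcard

/-- **(U_p) ⟹ (TR_p)** (tight layer): `v Z Y := Σ_S f Z S Y / C(#S, q)` — a member receives at least the sum of the weights
of its units, which is its defect (`sum_lost_through_eq_lymDefect`); the loads are those of the units. -/
theorem bigTransportP_of_unitTransport (p q : ℕ) (hE : M.E.ncard = p + q) (hpq : q < p)
    (h : UnitTransport M p q) : BigTransportP M p q := by
  classical
  obtain ⟨f, hnn, hsupp, hdem, hcap⟩ := h
  set Lf : Finset (Set α) := (lostSets_finite M p q).toFinset with hLf
  set Bf : Finset (Set α) := (bigY_finite M p q).toFinset with hBf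
  have hmemL : ∀ S, S ∈ Lf ↔ S ∈ lostSets M p q := fun S => by
    rw [hLf, (lostSets_finite M p q).mem_toFinset]
  refine ⟨fun Z Y => ∑ S ∈ Lf, f Z S Y / ((S.ncard.choose q : ℕ) : ℚ), ?_, ?_, ?_, ?_⟩
  · intro Z Y
    dsimp only
    exact Finset.sum_nonneg (fun S _ => div_nonneg (hnn Z S Y) (by positivity))
  · intro Z Y hv
    dsimp only at hv
    obtain ⟨S, _, hne⟩ := Finset.exists_ne_zero_of_sum_ne_zero hv
    have hf : f Z S Y ≠ 0 := fun h0 => hne (by rw [h0, zero_div])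
    obtain ⟨_, _, hZS, hSY, hYB, hYp⟩ := hsupp Z S Y hf
    exact ⟨hZS.trans hSY, hYB, hYp⟩
  · intro Z hZ
    dsimp only
    rw [Finset.sum_comm]
    -- the units through `Z` each bring at least `1/C(#S, q)`
    have hunit : ∀ S ∈ Lf, (if Z ⊆ S then 1 / ((S.ncard.choose q : ℕ) : ℚ) else 0)
        ≤ ∑ Y ∈ Bf, f Z S Y / ((S.ncard.choose q : ℕ) : ℚ) := by
      intro S hSL
      rw [hmemL] at hSL
      rw [← Finset.sum_div]
      by_cases hZS : Z ⊆ S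
      · rw [if_pos hZS]
        have hpos : (0 : ℚ) < ((S.ncard.choose q : ℕ) : ℚ) := by
          exact_mod_cast Nat.choose_pos hSL.2.2.1.le
        rw [one_div, div_eq_inv_mul]
        have := mul_le_mul_of_nonneg_left (hdem Z hZ S hSL hZS) (inv_nonneg.2 hpos.le)
        rwa [mul_one] at this
      · rw [if_neg hZS]
        exact div_nonneg (Finset.sum_nonneg (fun Y _ => hnn Z S Y)) (by positivity)
    refine le_trans ?_ (Finset.sum_le_sum hunit)
    rw [← Finset.sum_filter]
    exact le_of_eq (sum_lost_through_eq_lymDefect M p q hE hpq hZ).symm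
  · intro Y hYB
    dsimp only
    exact hcap Y hYB

/-- **THE TRANSFER**: at the tight layer `#E = p + q` with `q < p`, a unit transport (`UnitTransport M p q`) gives the UP-Hall
condition for every family of members. -/
theorem hallUp_of_ncard_eq_of_unitTransport (p q : ℕ) (hE : M.E.ncard = p + q) (hpq : q < p)
    (h : UnitTransport M p q) (𝒜 : Set (Set α)) (h𝒜 : 𝒜 ⊆ cellMembers M p q) :
    phiK p q * (𝒜.ncard : ℚ) ≤ ((upNbhd M p q 𝒜).ncard : ℚ) :=
  hallUp_of_ncard_eq_of_bigTransport M p q hE hpq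
    (bigTransport_of_bigTransportP M p q (bigTransportP_of_unitTransport M p q hE hpq h)) 𝒜 h𝒜

end PercRepro
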